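import Literature.Analysis.FluidPDE.DriftHeatLocalClass
import Literature.Analysis.FluidPDE.LiebermanBarrier
import HarnessLib

/-!
# An interior Lipschitz estimate for the drift–heat class `uₜ + a·∇u − Δu = 0` (Ishii–Lions)

Analysis/FluidPDE proofs file (theorems and three explicit constants), a layer of the discharge
of the named fact `Literature.Analysis.FluidPDE.KNSS2009_lemma21` (`KNSSSwirlLiouville`;
Koch–Nadirashvili–Seregin–Šverák, *Liouville theorems for the Navier–Stokes equations and
applications*, Acta Math. 203 (2009) = arXiv:0709.3599, **Lemma 2.1**, p. 5: stability of the
strong maximum principle on a bounded domain, `δ` uniform in the drift bound `‖a‖_∞ ≤ A`).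

The tree already has the first layers of this discharge for the local time-integrated class
`IsDriftHeatSolutionOn a u A S U` (`DriftHeatLocalClass`: the class, `neg`/`add_const`,
integrability, joint continuity; `DriftHeatLocalComparison`: the localised comparison principle
of Lieberman, Ch. II, Cor. 2.5; `DriftHeatOscillation`, `KNSSLemma21OfHarnack`: Lemma 2.1 *from*
the interior Harnack inequality `Lieberman1996_harnack_drift`, a named fact). The printed proof
of Lemma 2.1 obtains the uniformity of `δ` from the interior regularity theory of [LSU]; this
file proves the needed equicontinuity **unconditionally**, as an interior Lipschitz estimate in
space depending only on the bound for `|u|`, the drift bound, the dimension and the size of a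
parabolic cylinder — so that Lemma 2.1 follows without any Harnack or regularity input
(`KNSSLemma21Proof`):

* `IsDriftHeatSolutionOn.sub_le_lipConst`, `IsDriftHeatSolutionOn.abs_sub_le_lipConst`: if
  `|u| ≤ M` on `[t₀ − ρ², t₀] × B̄(x₀, 2ρ)` (inside `S × U`, `U` open), then
  `|u(t₀, y) − u(t₀, x₀)| ≤ K M ‖y − x₀‖` for `‖y − x₀‖ ≤ ρ/(1 + Aρ)`, with the explicit
  `K = lipConst A ρ n` (`n = dim E`).

## Proof (the Ishii–Lions doubling method)

Maximise `Φ(t, x, y) = u(t, x) − u(t, y) − φ(‖x − y‖) − κ‖x − x₀‖² − κ(t₀ − t)` over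
`t ∈ [t₀ − ρ², t₀]`, `‖x − x₀‖ ≤ ρ`, `‖x − y‖ ≤ d₀`, with `κ = 2M/ρ²` and the concave
`φ(r) = K₁ r − K₂ r²`, `φ(d₀) ≥ 2M`. If the maximum were positive, it would be attained at a point
`(t', x', y')` off the boundary, with `x' ≠ y'`; there the first-order conditions give
`∇u(t', y') = φ'(d) e`, `∇u(t', x') = φ'(d) e + 2κ(x' − x₀)` (`e = (x' − y')/d`, `d = ‖x' − y'‖`),
the second-order conditions along the lines `(x' + h bᵢ, y' + h bᵢ)` of an orthonormal frame
containing `e` and along `(x' + h e, y' − h e)` sum to `Δu(t', x') − Δu(t', y') ≤ 4φ''(d) + 2κn`,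
and comparing `Φ(t, x', y') ≤ Φ(t', x', y')` for `t ↑ t'` with the integrated equations at `x'`
and `y'` gives `0 ≤ 4φ''(d) + 2κ n + A(‖∇u(t',x')‖ + ‖∇u(t',y')‖) + κ ≤ −4K₂(1 − A d₀) < 0`.
Hence `Φ ≤ 0`, and `Φ(t₀, x₀, y) ≤ 0` is the claim. Only maximum-point calculus is used (the same
device, for the drift-free backward heat operator and globally `C²` functions, is the tree's
`Carleman.doubling_sub_le`, `BackwardHeatGradientDoubling`).

## References

* G. Koch, N. Nadirashvili, G. Seregin, V. Šverák, Acta Math. 203 (2009) 83–105 =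
  arXiv:0709.3599, Lemma 2.1 (p. 5) and its reference [LSU]. [KochNadirashviliSereginSverak2009]
* H. Ishii, P.-L. Lions, *Viscosity solutions of fully nonlinear second-order elliptic partial
  differential equations*, J. Differential Equations 83 (1990) 26–78, §VII (the doubling method
  for Lipschitz regularity; folklore rendering, no statement of that paper is vendored).
-/

noncomputable section

open MeasureTheory Set Function Filter TopologicalSpace InnerProductSpace Metric
open scoped RealInnerProductSpace Laplacian ContDiff Topology

namespace Literature.Analysis.FluidPDE

variable {E : Type*} [NormedAddCommGroup E] [InnerProductSpace ℝ E] [FiniteDimensional ℝ E]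

/-! ### Calculus preliminaries -/

section Prelim

omit [FiniteDimensional ℝ E] in
/-- The line through `x` in direction `e` stays in the open set `U ∋ x` for small parameters.
[folklore] -/
theorem eventually_line_mem {U : Set E} (hU : IsOpen U) {x : E} (hx : x ∈ U) (e : E) :
    ∀ᶠ σ in 𝓝 (0 : ℝ), x + σ • e ∈ U := by
  have hl : Continuous fun σ : ℝ => x + σ • e := by fun_prop
  have h0 : x + (0 : ℝ) • e ∈ U := by simpa using hx
  exact hl.continuousAt.preimage_mem_nhds (hU.mem_nhds h0)

omit [FiniteDimensional ℝ E] in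
/-- `D‖z − c‖ = ‖z − c‖⁻¹ ⟨z − c, ·⟩` at `z ≠ c`. [folklore] -/
theorem hasFDerivAt_norm_sub {c z : E} (h : z ≠ c) :
    HasFDerivAt (fun w : E => ‖w - c‖) (‖z - c‖⁻¹ • innerSL ℝ (z - c)) z := by
  have hne : ‖z - c‖ ≠ 0 := norm_ne_zero_iff.2 (sub_ne_zero.2 h)
  have hsq : ‖z - c‖ ^ 2 ≠ 0 := pow_ne_zero 2 hne
  have h1 := (hasFDerivAt_norm_sub_sq c z).sqrt hsq
  have hfun : (fun w : E => Real.sqrt (‖w - c‖ ^ 2)) = fun w => ‖w - c‖ :=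
    funext fun w => Real.sqrt_sq (norm_nonneg _)
  rw [hfun] at h1
  refine h1.congr_fderiv ?_
  rw [Real.sqrt_sq (norm_nonneg _), smul_smul]
  congr 1
  field_simp

omit [FiniteDimensional ℝ E] in
/-- Along a line through a point of differentiability: `(d/dσ) W(x + σ v) = DW(x + σ v) v`.
[folklore] -/
theorem hasDerivAt_line_of_differentiableAt {W : E → ℝ} {x v : E} {σ : ℝ}
    (hW : DifferentiableAt ℝ W (x + σ • v)) :
    HasDerivAt (fun s : ℝ => W (x + s • v)) (fderiv ℝ W (x + σ • v) v) σ := by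
  have hl : HasDerivAt (fun s : ℝ => x + s • v) v σ := by
    simpa using ((hasDerivAt_id σ).smul_const v).const_add x
  exact hW.hasFDerivAt.comp_hasDerivAt σ hl

omit [FiniteDimensional ℝ E] in
/-- The derivative at `0` of `σ ↦ DW(x + σ v) e` is `D²W(x)(v, e)`, for `W` of class `C²` on an
open set containing `x`. [folklore] -/
theorem hasDerivAt_fderiv_line {W : E → ℝ} {U : Set E} (hU : IsOpen U) (hW : ContDiffOn ℝ 2 W U)
    {x : E} (hx : x ∈ U) (v e : E) :
    HasDerivAt (fun σ : ℝ => fderiv ℝ W (x + σ • v) e) (iteratedFDeriv ℝ 2 W x ![v, e]) 0 := by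
  have hD1 : ContDiffOn ℝ 1 (fun z => fderiv ℝ W z) U := hW.fderiv_of_isOpen hU le_rfl
  have hD1d : DifferentiableAt ℝ (fderiv ℝ W) x :=
    (hD1.differentiableOn one_ne_zero).differentiableAt (hU.mem_nhds hx)
  have hF : DifferentiableAt ℝ (fun z => fderiv ℝ W z e) x :=
    hD1d.clm_apply (differentiableAt_const e)
  have hx0 : x + (0 : ℝ) • v = x := by simp
  have hF0 : DifferentiableAt ℝ (fun z => fderiv ℝ W z e) (x + (0 : ℝ) • v) := by rwa [hx0]
  have hl0 : HasDerivAt (fun σ : ℝ => x + σ • v) v 0 := by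
    simpa using ((hasDerivAt_id (0 : ℝ)).smul_const v).const_add x
  have h := hF0.hasFDerivAt.comp_hasDerivAt (0 : ℝ) hl0
  rw [hx0] at h
  have hval : fderiv ℝ (fun z => fderiv ℝ W z e) x v = iteratedFDeriv ℝ 2 W x ![v, e] := by
    rw [iteratedFDeriv_two_apply, fderiv_clm_apply hD1d (differentiableAt_const e)]
    simp
  rw [← hval]
  exact h

/-- The quadratic penalisation `φ(r) = K₁ r − K₂ r²` and its derivative. [folklore] -/
theorem hasDerivAt_quadPen (K₁ K₂ r : ℝ) :
    HasDerivAt (fun s : ℝ => K₁ * s - K₂ * s ^ 2) (K₁ - 2 * K₂ * r) r := by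
  have h1 : HasDerivAt (fun s : ℝ => K₁ * s) K₁ r := by
    simpa using (hasDerivAt_id r).const_mul K₁
  have h2 : HasDerivAt (fun s : ℝ => K₂ * s ^ 2) (K₂ * (2 * r)) r := by
    simpa using (hasDerivAt_pow 2 r).const_mul K₂
  exact (h1.sub h2).congr_deriv (by ring)

end Prelim

/-! ### The constants -/

section Constants

/-- The radius `d₀ = ρ/(1 + Aρ)` on which the Lipschitz estimate is stated (`A d₀ < 1`).
[folklore] -/
def lipRad (A ρ : ℝ) : ℝ := ρ / (1 + A * ρ)

/-- The auxiliary constant `c₁/M = (n + 1/2)/ρ² + A/ρ` of the doubling argument. [folklore] -/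
def lipAux (A ρ n : ℝ) : ℝ := (n + 1 / 2) / ρ ^ 2 + A / ρ

/-- The Lipschitz constant (per unit of `M`): `K₁/M = 4/d₀ + 2 (c₁/M) d₀`. [folklore] -/
def lipConst (A ρ n : ℝ) : ℝ := 4 / lipRad A ρ + 2 * lipAux A ρ n * lipRad A ρ

/-- `d₀ > 0`. [folklore] -/
theorem lipRad_pos {A ρ : ℝ} (hA : 0 ≤ A) (hρ : 0 < ρ) : 0 < lipRad A ρ := by
  unfold lipRad; positivity

/-- `d₀ ≤ ρ`. [folklore] -/
theorem lipRad_le {A ρ : ℝ} (hA : 0 ≤ A) (hρ : 0 < ρ) : lipRad A ρ ≤ ρ := by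
  unfold lipRad
  rw [div_le_iff₀ (by positivity)]
  nlinarith [mul_nonneg (mul_nonneg hA hρ.le) hρ.le]

/-- `A d₀ < 1`. [folklore] -/
theorem mul_lipRad_lt_one {A ρ : ℝ} (hA : 0 ≤ A) (hρ : 0 < ρ) : A * lipRad A ρ < 1 := by
  unfold lipRad
  rw [← mul_div_assoc, div_lt_one (by positivity)]
  linarith

/-- `c₁/M > 0`. [folklore] -/
theorem lipAux_pos {A ρ n : ℝ} (hA : 0 ≤ A) (hρ : 0 < ρ) (hn : 0 ≤ n) : 0 < lipAux A ρ n := by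
  unfold lipAux; positivity

/-- `K₁/M > 0`. [folklore] -/
theorem lipConst_pos {A ρ n : ℝ} (hA : 0 ≤ A) (hρ : 0 < ρ) (hn : 0 ≤ n) : 0 < lipConst A ρ n := by
  have := lipRad_pos hA hρ
  have := lipAux_pos hA hρ hn
  unfold lipConst; positivity

end Constants

/-! ### Two more calculus facts -/

section Prelim2

omit [FiniteDimensional ℝ E] in
/-- Second derivative at `0` from an eventual first derivative. [folklore] -/
theorem deriv_deriv_eq_of_eventually {ℓ D₁ : ℝ → ℝ} {v : ℝ}
    (hev : ∀ᶠ h in 𝓝 (0 : ℝ), HasDerivAt ℓ (D₁ h) h) (hD : HasDerivAt D₁ v 0) :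
    deriv (deriv ℓ) 0 = v := by
  have h1 : deriv ℓ =ᶠ[𝓝 0] D₁ := hev.mono fun h hh => hh.deriv
  rw [h1.deriv_eq]
  exact hD.deriv

omit [FiniteDimensional ℝ E] in
/-- `(d/dh) ‖x + h v − c‖² = 2⟨x + h v − c, v⟩`. [folklore] -/
theorem hasDerivAt_norm_sq_line (x v c : E) (h : ℝ) :
    HasDerivAt (fun s : ℝ => ‖x + s • v - c‖ ^ 2) (2 * ⟪x + h • v - c, v⟫) h := by
  have hl : HasDerivAt (fun s : ℝ => x + s • v) v h := by
    simpa using ((hasDerivAt_id h).smul_const v).const_add x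
  have h1 := (hasFDerivAt_norm_sub_sq c (x + h • v)).comp_hasDerivAt h hl
  refine h1.congr_deriv ?_
  simp only [FunLike.coe_smul, Pi.smul_apply, innerSL_apply_apply, smul_eq_mul]

omit [FiniteDimensional ℝ E] in
/-- `(d/dh) ⟨x + h v − c, v⟩ = ‖v‖²`. [folklore] -/
theorem hasDerivAt_inner_line (x v c : E) (h : ℝ) :
    HasDerivAt (fun s : ℝ => ⟪x + s • v - c, v⟫) (‖v‖ ^ 2) h := by
  have hfun : (fun s : ℝ => ⟪x + s • v - c, v⟫) = fun s => ⟪x - c, v⟫ + s * ‖v‖ ^ 2 := by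
    funext s
    rw [show x + s • v - c = (x - c) + s • v by abel, inner_add_left, real_inner_smul_left,
      real_inner_self_eq_norm_sq]
  rw [hfun]
  simpa using ((hasDerivAt_id h).mul_const (‖v‖ ^ 2)).const_add ⟪x - c, v⟫

end Prelim2

/-! ### The interior Lipschitz estimate -/

section Lipschitz

variable [MeasurableSpace E] [BorelSpace E]
variable {Ω : Set E} {S : Set ℝ} {A : ℝ} {a : ℝ → E → E} {u : ℝ → E → ℝ}

omit [BorelSpace E] in
/-- The drift–gradient pairing is dominated: `|Du(τ,·)(x)[a(τ, x)]| ≤ A ‖Du(τ,·)(x)‖`. [folklore] -/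
theorem IsDriftHeatSolutionOn.abs_fderiv_apply_drift_le (hu : IsDriftHeatSolutionOn a u A S Ω)
    {τ : ℝ} (hτ : τ ∈ S) {x : E} (hx : x ∈ Ω) :
    |fderiv ℝ (u τ) x (a τ x)| ≤ A * ‖fderiv ℝ (u τ) x‖ := by
  rw [← Real.norm_eq_abs]
  calc ‖fderiv ℝ (u τ) x (a τ x)‖ ≤ ‖fderiv ℝ (u τ) x‖ * ‖a τ x‖ :=
        ContinuousLinearMap.le_opNorm _ _
    _ ≤ ‖fderiv ℝ (u τ) x‖ * A :=
        mul_le_mul_of_nonneg_left (hu.norm_drift_le τ hτ x hx) (norm_nonneg _)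
    _ = A * ‖fderiv ℝ (u τ) x‖ := mul_comm _ _

set_option maxHeartbeats 800000 in
/-- **Interior Lipschitz estimate in space for the drift–heat class (one-sided form).** If `u`
is in the local class on `S × Ω` (`Ω` open), `B̄(x₀, 2ρ) ⊆ Ω`, `[t₀ − ρ², t₀] ⊆ S` and
`|u| ≤ M` on `[t₀ − ρ², t₀] × B̄(x₀, 2ρ)` (`M > 0`), then
`u(t₀, x₀) − u(t₀, y) ≤ lipConst A ρ n · M · ‖x₀ − y‖` for `‖y − x₀‖ ≤ lipRad A ρ`
(`n = dim E`). Proof: the Ishii–Lions doubling argument described in the module docstring; it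
serves the discharge of KNSS 2009, Lemma 2.1. [folklore] -/
theorem IsDriftHeatSolutionOn.sub_le_lipConst (hu : IsDriftHeatSolutionOn a u A S Ω)
    (hΩ : IsOpen Ω) {x₀ : E} {t₀ ρ M : ℝ} (hρ : 0 < ρ) (hM : 0 < M)
    (hball : closedBall x₀ (2 * ρ) ⊆ Ω) (hS : Icc (t₀ - ρ ^ 2) t₀ ⊆ S)
    (hbd : ∀ t ∈ Icc (t₀ - ρ ^ 2) t₀, ∀ x ∈ closedBall x₀ (2 * ρ), |u t x| ≤ M) :
    ∀ y ∈ closedBall x₀ (lipRad A ρ),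
      u t₀ x₀ - u t₀ y ≤ lipConst A ρ (Module.finrank ℝ E) * M * ‖x₀ - y‖ := by
  -- membership facts
  have hρ2 : 0 ≤ ρ ^ 2 := sq_nonneg ρ
  have ht₀I : t₀ ∈ Icc (t₀ - ρ ^ 2) t₀ := ⟨by linarith only [hρ2], le_rfl⟩
  have hx₀Ω : x₀ ∈ Ω := hball (mem_closedBall_self (by positivity))
  have hA : 0 ≤ A := hu.drift_bound_nonneg (hS ht₀I) hx₀Ω
  -- constants
  set n : ℝ := (Module.finrank ℝ E : ℝ) with hn
  have hn0 : 0 ≤ n := by rw [hn]; positivity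
  set d₀ : ℝ := lipRad A ρ with hd₀def
  have hd₀ : 0 < d₀ := lipRad_pos hA hρ
  have hd₀ρ : d₀ ≤ ρ := lipRad_le hA hρ
  have hAd₀ : A * d₀ < 1 := mul_lipRad_lt_one hA hρ
  set κ : ℝ := 2 * M / ρ ^ 2 with hκ
  have hκpos : 0 < κ := by rw [hκ]; positivity
  have hκρ : κ * ρ ^ 2 = 2 * M := by rw [hκ]; field_simp
  set c₁ : ℝ := M * lipAux A ρ n with hc₁
  have hc₁pos : 0 < c₁ := by rw [hc₁]; exact mul_pos hM (lipAux_pos hA hρ hn0)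
  set K₁ : ℝ := M * lipConst A ρ n with hK₁
  have hK₁pos : 0 < K₁ := by rw [hK₁]; exact mul_pos hM (lipConst_pos hA hρ hn0)
  set K₂ : ℝ := c₁ + A * K₁ / 2 with hK₂
  have hK₂pos : 0 < K₂ := by rw [hK₂]; positivity
  have hK₁d₀ : K₁ * d₀ = 4 * M + 2 * c₁ * d₀ ^ 2 := by
    rw [hK₁, hc₁, lipConst, ← hd₀def]
    field_simp
  have hc₁eq : 4 * c₁ = 2 * κ * n + 2 * A * κ * ρ + κ := by
    rw [hc₁, hκ, lipAux]
    field_simp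
    ring
  -- the penalisation `φ`
  set φ : ℝ → ℝ := fun r => K₁ * r - K₂ * r ^ 2 with hφ
  have hφK₁ : ∀ r, φ r ≤ K₁ * r := fun r => by
    simp only [hφ]; nlinarith only [sq_nonneg r, hK₂pos.le]
  have hK₂d₀ : K₂ * d₀ ≤ K₁ := by
    have h1 : K₂ * d₀ = c₁ * d₀ + (A * d₀) * K₁ / 2 := by rw [hK₂]; ring
    have h2 : (A * d₀) * K₁ / 2 ≤ K₁ / 2 := by nlinarith only [hK₁pos.le, hAd₀.le]
    have h3 : 2 * c₁ * d₀ ≤ K₁ := by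
      have : 2 * c₁ * d₀ * d₀ ≤ K₁ * d₀ := by rw [hK₁d₀]; nlinarith only [hM.le]
      exact le_of_mul_le_mul_right this hd₀
    linarith only [h1, h2, h3]
  have hφnn : ∀ r, 0 ≤ r → r ≤ d₀ → 0 ≤ φ r := by
    intro r hr hrd
    have h1 : K₂ * r ≤ K₁ := (mul_le_mul_of_nonneg_left hrd hK₂pos.le).trans hK₂d₀
    have : φ r = r * (K₁ - K₂ * r) := by simp only [hφ]; ring
    rw [this]
    exact mul_nonneg hr (by linarith only [h1])
  have hφd₀ : 2 * M ≤ φ d₀ := by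
    have h1 : φ d₀ = K₁ * d₀ * (1 - A * d₀ / 2) - c₁ * d₀ ^ 2 := by
      simp only [hφ, hK₂]; ring
    rw [h1, hK₁d₀]
    have e1 : (4 * M + 2 * c₁ * d₀ ^ 2) * (1 - A * d₀ / 2) - c₁ * d₀ ^ 2 =
        2 * M + 2 * M * (1 - A * d₀) + c₁ * d₀ ^ 2 * (1 - A * d₀) := by ring
    rw [e1]
    have e2 : 0 ≤ 2 * M * (1 - A * d₀) := mul_nonneg (by positivity) (by linarith only [hAd₀])
    have e3 : 0 ≤ c₁ * d₀ ^ 2 * (1 - A * d₀) :=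
      mul_nonneg (by positivity) (by linarith only [hAd₀])
    linarith only [e2, e3]
  have hφ0 : φ 0 = 0 := by simp [hφ]
  have hφ'bd : ∀ r, 0 ≤ r → r ≤ d₀ → |K₁ - 2 * K₂ * r| ≤ K₁ + 2 * K₂ * d₀ := by
    intro r hr hrd
    have h1 : 0 ≤ K₂ * r := mul_nonneg hK₂pos.le hr
    have h2 : K₂ * r ≤ K₂ * d₀ := mul_le_mul_of_nonneg_left hrd hK₂pos.le
    rw [abs_le]
    constructor <;> linarith only [h1, h2, hK₁pos.le]
  have hφ' : ∀ r, HasDerivAt φ (K₁ - 2 * K₂ * r) r := fun r => hasDerivAt_quadPen K₁ K₂ r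
  -- the doubled function `Φ` on the compact set `K₀`
  set Φ : ℝ × E × E → ℝ := fun p =>
    u p.1 p.2.1 - u p.1 p.2.2 - φ ‖p.2.1 - p.2.2‖ - κ * ‖p.2.1 - x₀‖ ^ 2 - κ * (t₀ - p.1) with hΦ
  set K₀ : Set (ℝ × E × E) :=
    {p | p.1 ∈ Icc (t₀ - ρ ^ 2) t₀ ∧ ‖p.2.1 - x₀‖ ≤ ρ ∧ ‖p.2.1 - p.2.2‖ ≤ d₀} with hK₀
  have hSx : ∀ p ∈ K₀, p.2.1 ∈ closedBall x₀ (2 * ρ) := fun p hp =>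
    mem_closedBall_iff_norm.2 (hp.2.1.trans (by linarith only [hρ]))
  have hSy : ∀ p ∈ K₀, p.2.2 ∈ closedBall x₀ (2 * ρ) := by
    intro p hp
    rw [mem_closedBall_iff_norm]
    calc ‖p.2.2 - x₀‖ = ‖(p.2.1 - x₀) - (p.2.1 - p.2.2)‖ := by congr 1; abel
      _ ≤ ‖p.2.1 - x₀‖ + ‖p.2.1 - p.2.2‖ := norm_sub_le _ _
      _ ≤ ρ + d₀ := add_le_add hp.2.1 hp.2.2
      _ ≤ 2 * ρ := by linarith only [hd₀ρ]
  have hSc : IsCompact K₀ := by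
    have hsub : K₀ ⊆ Icc (t₀ - ρ ^ 2) t₀ ×ˢ (closedBall x₀ (2 * ρ) ×ˢ closedBall x₀ (2 * ρ)) :=
      fun p hp => ⟨hp.1, hSx p hp, hSy p hp⟩
    have hf1 : Continuous fun p : ℝ × E × E => ‖p.2.1 - x₀‖ := by fun_prop
    have hf2 : Continuous fun p : ℝ × E × E => ‖p.2.1 - p.2.2‖ := by fun_prop
    have hcl : IsClosed K₀ :=
      (isClosed_Icc.preimage continuous_fst).inter
        ((isClosed_le hf1 continuous_const).inter (isClosed_le hf2 continuous_const))
    exact (isCompact_Icc.prod ((isCompact_closedBall _ _).prod (isCompact_closedBall _ _)))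
      |>.of_isClosed_subset hcl hsub
  have huc : ContinuousOn (uncurry u) (Icc (t₀ - ρ ^ 2) t₀ ×ˢ Ω) := hu.continuousOn_uncurry hΩ hS
  have hΦc : ContinuousOn Φ K₀ := by
    have h1 : ContinuousOn (fun p : ℝ × E × E => u p.1 p.2.1) K₀ := by
      refine huc.comp (f := fun p : ℝ × E × E => (p.1, p.2.1)) (by fun_prop) fun p hp => ?_
      exact ⟨hp.1, hball (hSx p hp)⟩
    have h2 : ContinuousOn (fun p : ℝ × E × E => u p.1 p.2.2) K₀ := by
      refine huc.comp (f := fun p : ℝ × E × E => (p.1, p.2.2)) (by fun_prop) fun p hp => ?_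
      exact ⟨hp.1, hball (hSy p hp)⟩
    have h3 : Continuous fun p : ℝ × E × E =>
        φ ‖p.2.1 - p.2.2‖ + κ * ‖p.2.1 - x₀‖ ^ 2 + κ * (t₀ - p.1) := by
      simp only [hφ]; fun_prop
    have : Φ = fun p => u p.1 p.2.1 - u p.1 p.2.2 -
        (φ ‖p.2.1 - p.2.2‖ + κ * ‖p.2.1 - x₀‖ ^ 2 + κ * (t₀ - p.1)) := by
      funext p; simp only [hΦ]; ring
    rw [this]
    exact (h1.sub h2).sub h3.continuousOn
  -- **Claim**: `Φ ≤ 0` on `K₀`.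
  have claim : ∀ p ∈ K₀, Φ p ≤ 0 := by
    by_contra hcon
    push Not at hcon
    obtain ⟨p₁, hp₁S, hp₁⟩ := hcon
    obtain ⟨P, hPS, hPmax⟩ := hSc.exists_isMaxOn ⟨p₁, hp₁S⟩ hΦc
    have hPpos : 0 < Φ P := hp₁.trans_le (hPmax hp₁S)
    obtain ⟨ts, xs, ys⟩ := P
    obtain ⟨htsI, hxs, hxys⟩ := hPS
    simp only at htsI hxs hxys
    have hts : ts ∈ S := hS htsI
    have hxs2 : xs ∈ closedBall x₀ (2 * ρ) := hSx (ts, xs, ys) ⟨htsI, hxs, hxys⟩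
    have hys2 : ys ∈ closedBall x₀ (2 * ρ) := hSy (ts, xs, ys) ⟨htsI, hxs, hxys⟩
    have hxsΩ : xs ∈ Ω := hball hxs2
    have hysΩ : ys ∈ Ω := hball hys2
    have hux : |u ts xs| ≤ M := hbd ts htsI xs hxs2
    have huy : |u ts ys| ≤ M := hbd ts htsI ys hys2
    have hdiff : u ts xs - u ts ys ≤ 2 * M := by
      have h1 := (abs_le.1 hux).2; have h2 := (abs_le.1 huy).1; linarith only [h1, h2]
    have hΦP : Φ (ts, xs, ys) = u ts xs - u ts ys - φ ‖xs - ys‖ - κ * ‖xs - x₀‖ ^ 2 -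
        κ * (t₀ - ts) := by simp only [hΦ]
    have hφP : 0 ≤ φ ‖xs - ys‖ := hφnn _ (norm_nonneg _) hxys
    have hκP : 0 ≤ κ * ‖xs - x₀‖ ^ 2 := by positivity
    have hμP : 0 ≤ κ * (t₀ - ts) := mul_nonneg hκpos.le (by linarith only [htsI.2])
    -- (i) not at the bottom time
    have hts_gt : t₀ - ρ ^ 2 < ts := by
      refine lt_of_le_of_ne htsI.1 fun h => ?_
      have : κ * (t₀ - ts) = 2 * M := by rw [← h, ← hκρ]; ring
      linarith only [hΦP, hPpos, this, hdiff, hφP, hκP]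
    -- (ii) `xs` inside the ball
    have hxs_lt : ‖xs - x₀‖ < ρ := by
      refine lt_of_le_of_ne hxs fun h => ?_
      have : κ * ‖xs - x₀‖ ^ 2 = 2 * M := by rw [h, hκρ]
      linarith only [hΦP, hPpos, this, hdiff, hφP, hμP]
    -- (iii) `d < d₀`
    set d : ℝ := ‖xs - ys‖ with hd
    have hd_lt : d < d₀ := by
      refine lt_of_le_of_ne hxys fun h => ?_
      have : 2 * M ≤ φ d := by rw [h]; exact hφd₀
      linarith only [hΦP, hPpos, this, hdiff, hκP, hμP]
    -- (iv) `0 < d`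
    have hd_pos : 0 < d := by
      refine lt_of_le_of_ne (norm_nonneg _) fun h => ?_
      have hn0' : ‖xs - ys‖ = 0 := by rw [← hd]; exact h.symm
      have hxy : xs = ys := sub_eq_zero.1 (norm_eq_zero.1 hn0')
      have h0 : φ d = 0 := by rw [← h, hφ0]
      have h1 : u ts xs - u ts ys = 0 := by rw [hxy, sub_self]
      linarith only [hΦP, hPpos, h0, h1, hκP, hμP]
    have hd0 : d ≠ 0 := hd_pos.ne'
    have hxy_ne : xs ≠ ys := fun h => by
      have : d = 0 := by rw [hd, h, sub_self, norm_zero]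
      exact hd0 this
    have hyx_ne : ys ≠ xs := fun h => hxy_ne h.symm
    -- the unit vector `e`
    set e : E := d⁻¹ • (xs - ys) with he
    have he1 : ‖e‖ = 1 := by
      rw [he, norm_smul, norm_inv, Real.norm_eq_abs, abs_of_pos hd_pos, ← hd,
        inv_mul_cancel₀ hd0]
    have hde : xs - ys = d • e := by rw [he, smul_smul, mul_inv_cancel₀ hd0, one_smul]
    -- smoothness at the maximum point
    have huC : ContDiffOn ℝ 2 (u ts) Ω := hu.contDiffOn ts hts
    have huDiff : ∀ z ∈ Ω, DifferentiableAt ℝ (u ts) z := fun z hz =>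
      (huC.differentiableOn (by norm_num)).differentiableAt (hΩ.mem_nhds hz)
    -- local maximality in the space variables at time `ts`
    have hloc : ∀ᶠ q in 𝓝 (xs, ys), Φ (ts, q.1, q.2) ≤ Φ (ts, xs, ys) := by
      have hc1 : Continuous fun q : E × E => ‖q.1 - x₀‖ := by fun_prop
      have hc2 : Continuous fun q : E × E => ‖q.1 - q.2‖ := by fun_prop
      have hopen : IsOpen ({q : E × E | ‖q.1 - x₀‖ < ρ} ∩ {q : E × E | ‖q.1 - q.2‖ < d₀}) :=
        (isOpen_lt hc1 continuous_const).inter (isOpen_lt hc2 continuous_const)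
      have hmem : (xs, ys) ∈ {q : E × E | ‖q.1 - x₀‖ < ρ} ∩ {q : E × E | ‖q.1 - q.2‖ < d₀} :=
        ⟨hxs_lt, hd_lt⟩
      filter_upwards [hopen.mem_nhds hmem] with q hq
      exact hPmax (show (ts, q.1, q.2) ∈ K₀ from ⟨htsI, hq.1.le, hq.2.le⟩)
    -- transfer of local maximality along continuous maps into `E × E`
    have hmax_of : ∀ (g : ℝ → E × E) (z : ℝ),
        Continuous g → g z = (xs, ys) → IsLocalMax (fun w => Φ (ts, (g w).1, (g w).2)) z := by
      intro g z hg hgz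
      have ht : Tendsto g (𝓝 z) (𝓝 (xs, ys)) := by
        have h := hg.continuousAt (x := z)
        rwa [ContinuousAt, hgz] at h
      refine (ht.eventually hloc).mono fun w hw => ?_
      show Φ (ts, (g w).1, (g w).2) ≤ Φ (ts, (g z).1, (g z).2)
      rw [hgz]
      exact hw
    have hmax_ofE : ∀ (g : E → E × E) (z : E),
        Continuous g → g z = (xs, ys) → IsLocalMax (fun w => Φ (ts, (g w).1, (g w).2)) z := by
      intro g z hg hgz
      have ht : Tendsto g (𝓝 z) (𝓝 (xs, ys)) := by
        have h := hg.continuousAt (x := z)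
        rwa [ContinuousAt, hgz] at h
      refine (ht.eventually hloc).mono fun w hw => ?_
      show Φ (ts, (g w).1, (g w).2) ≤ Φ (ts, (g z).1, (g z).2)
      rw [hgz]
      exact hw
    have hcy : Continuous fun y : E => (xs, y) := continuous_const.prodMk continuous_id
    have hcx : Continuous fun x : E => (x, ys) := continuous_id.prodMk continuous_const
    ----------------------------------------------------------------
    -- first-order conditions: the gradients at `ys` and at `xs`
    ----------------------------------------------------------------
    -- at `ys`
    have hDy : ‖fderiv ℝ (u ts) ys‖ ≤ |K₁ - 2 * K₂ * d| := by
      have hmaxY : IsLocalMax (fun y => Φ (ts, xs, y)) ys := hmax_ofE (fun y : E => (xs, y)) ys hcy rfl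
      have hN : HasFDerivAt (fun y : E => ‖y - xs‖) (‖ys - xs‖⁻¹ • innerSL ℝ (ys - xs)) ys :=
        hasFDerivAt_norm_sub hyx_ne
      have hdyx : ‖ys - xs‖ = d := by rw [hd, norm_sub_rev]
      have hφN : HasFDerivAt (fun y : E => φ ‖y - xs‖)
          ((K₁ - 2 * K₂ * d) • (‖ys - xs‖⁻¹ • innerSL ℝ (ys - xs))) ys := by
        have h := (hφ' ‖ys - xs‖).comp_hasFDerivAt ys hN
        exact h.congr_fderiv (by rw [hdyx])
      have hU : HasFDerivAt (fun y => u ts y) (fderiv ℝ (u ts) ys) ys :=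
        (huDiff ys hysΩ).hasFDerivAt
      have hΦy : HasFDerivAt (fun y => Φ (ts, xs, y))
          (0 - fderiv ℝ (u ts) ys - (K₁ - 2 * K₂ * d) • (‖ys - xs‖⁻¹ • innerSL ℝ (ys - xs)) - 0)
          ys := by
        have h2 := (((hasFDerivAt_const (u ts xs) ys).sub hU).sub hφN).sub
          (hasFDerivAt_const (κ * ‖xs - x₀‖ ^ 2 + κ * (t₀ - ts)) ys)
        have hfun : (fun y => Φ (ts, xs, y)) = fun y =>
            u ts xs - u ts y - φ ‖y - xs‖ - (κ * ‖xs - x₀‖ ^ 2 + κ * (t₀ - ts)) := by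
          funext y; simp only [hΦ, norm_sub_rev xs y]; ring
        rw [hfun]
        exact h2
      have hzero := hmaxY.hasFDerivAt_eq_zero hΦy
      have hgrad : fderiv ℝ (u ts) ys =
          -((K₁ - 2 * K₂ * d) • (‖ys - xs‖⁻¹ • innerSL ℝ (ys - xs))) := by
        rw [zero_sub, sub_zero, sub_eq_zero, neg_eq_iff_eq_neg] at hzero
        exact hzero
      rw [hgrad, norm_neg, norm_smul, norm_smul, norm_inv, norm_norm, innerSL_apply_norm, hdyx,
        Real.norm_eq_abs, inv_mul_cancel₀ hd0, mul_one]
    -- at `xs`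
    have hDx : ‖fderiv ℝ (u ts) xs‖ ≤ |K₁ - 2 * K₂ * d| + 2 * κ * ρ := by
      have hmaxX : IsLocalMax (fun x => Φ (ts, x, ys)) xs := hmax_ofE (fun x : E => (x, ys)) xs hcx rfl
      have hN : HasFDerivAt (fun x : E => ‖x - ys‖) (‖xs - ys‖⁻¹ • innerSL ℝ (xs - ys)) xs :=
        hasFDerivAt_norm_sub hxy_ne
      have hφN : HasFDerivAt (fun x : E => φ ‖x - ys‖)
          ((K₁ - 2 * K₂ * d) • (‖xs - ys‖⁻¹ • innerSL ℝ (xs - ys))) xs := by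
        have h := (hφ' ‖xs - ys‖).comp_hasFDerivAt xs hN
        exact h
      have hP : HasFDerivAt (fun x : E => κ * ‖x - x₀‖ ^ 2) (κ • ((2 : ℝ) • innerSL ℝ (xs - x₀)))
          xs := (hasFDerivAt_norm_sub_sq x₀ xs).const_mul κ
      have hU : HasFDerivAt (fun x => u ts x) (fderiv ℝ (u ts) xs) xs :=
        (huDiff xs hxsΩ).hasFDerivAt
      have hΦx : HasFDerivAt (fun x => Φ (ts, x, ys))
          (fderiv ℝ (u ts) xs - 0 - (K₁ - 2 * K₂ * d) • (‖xs - ys‖⁻¹ • innerSL ℝ (xs - ys)) -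
            κ • ((2 : ℝ) • innerSL ℝ (xs - x₀)) - 0) xs := by
        have h1 := (((hU.sub (hasFDerivAt_const (u ts ys) xs)).sub hφN).sub hP).sub
          (hasFDerivAt_const (κ * (t₀ - ts)) xs)
        have hfun : (fun x => Φ (ts, x, ys)) = fun x =>
            u ts x - u ts ys - φ ‖x - ys‖ - κ * ‖x - x₀‖ ^ 2 - κ * (t₀ - ts) := by
          funext x; simp only [hΦ]
        rw [hfun]
        exact h1
      have hzero := hmaxX.hasFDerivAt_eq_zero hΦx
      have hgrad : fderiv ℝ (u ts) xs = (K₁ - 2 * K₂ * d) • (‖xs - ys‖⁻¹ • innerSL ℝ (xs - ys)) +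
          κ • ((2 : ℝ) • innerSL ℝ (xs - x₀)) := by
        rw [sub_zero, sub_zero, sub_sub, sub_eq_zero] at hzero
        exact hzero
      rw [hgrad]
      refine (norm_add_le _ _).trans (add_le_add ?_ ?_)
      · rw [norm_smul, norm_smul, norm_inv, norm_norm, innerSL_apply_norm, ← hd, Real.norm_eq_abs,
          inv_mul_cancel₀ hd0, mul_one]
      · rw [norm_smul, norm_smul, innerSL_apply_norm, Real.norm_eq_abs, abs_of_pos hκpos,
          Real.norm_two]
        nlinarith only [hxs, hκpos.le, norm_nonneg (xs - x₀)]
    ----------------------------------------------------------------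
    -- second-order conditions
    ----------------------------------------------------------------
    have hD2 : ∀ z ∈ Ω, ∀ v w : E, HasDerivAt (fun σ : ℝ => fderiv ℝ (u ts) (z + σ • v) w)
        (iteratedFDeriv ℝ 2 (u ts) z ![v, w]) 0 := fun z hz v w =>
      hasDerivAt_fderiv_line hΩ huC hz v w
    -- (a) parallel lines: `D²u(xs)(b,b) − D²u(ys)(b,b) ≤ 2κ` for every unit vector `b`
    have hpar : ∀ b : E, ‖b‖ = 1 →
        iteratedFDeriv ℝ 2 (u ts) xs ![b, b] - iteratedFDeriv ℝ 2 (u ts) ys ![b, b] ≤ 2 * κ := by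
      intro b hb
      have hcl : Continuous fun h : ℝ => (xs + h • b, ys + h • b) := by fun_prop
      have hℓmax : IsLocalMax (fun h : ℝ => Φ (ts, xs + h • b, ys + h • b)) 0 :=
        hmax_of (fun h : ℝ => (xs + h • b, ys + h • b)) 0 hcl (by simp)
      -- the explicit form of the line function
      have hℓeq : (fun h : ℝ => Φ (ts, xs + h • b, ys + h • b)) = fun h =>
          u ts (xs + h • b) - u ts (ys + h • b) - φ d -
            κ * ‖xs + h • b - x₀‖ ^ 2 - κ * (t₀ - ts) := by
        funext h
        have h1 : xs + h • b - (ys + h • b) = xs - ys := by abel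
        simp only [hΦ, h1, hd]
      rw [hℓeq] at hℓmax
      -- first derivative near `0`
      obtain ⟨D₁, hD₁⟩ : ∃ D₁ : ℝ → ℝ, D₁ = fun h => fderiv ℝ (u ts) (xs + h • b) b -
          fderiv ℝ (u ts) (ys + h • b) b - κ * (2 * ⟪xs + h • b - x₀, b⟫) := ⟨_, rfl⟩
      have hxs_ev : ∀ᶠ h in 𝓝 (0 : ℝ), xs + h • b ∈ Ω := eventually_line_mem hΩ hxsΩ b
      have hys_ev : ∀ᶠ h in 𝓝 (0 : ℝ), ys + h • b ∈ Ω := eventually_line_mem hΩ hysΩ b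
      have hev : ∀ᶠ h in 𝓝 (0 : ℝ), HasDerivAt (fun h : ℝ => u ts (xs + h • b) - u ts (ys + h • b) -
          φ d - κ * ‖xs + h • b - x₀‖ ^ 2 - κ * (t₀ - ts)) (D₁ h) h := by
        filter_upwards [hxs_ev, hys_ev] with h hxh hyh
        have h1 := hasDerivAt_line_of_differentiableAt (huDiff _ hxh)
        have h2 := hasDerivAt_line_of_differentiableAt (huDiff _ hyh)
        have h3 := (hasDerivAt_norm_sq_line xs b x₀ h).const_mul κ
        have h4 := (((h1.sub h2).sub (hasDerivAt_const h (φ d))).sub h3).sub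
          (hasDerivAt_const h (κ * (t₀ - ts)))
        rw [hD₁]
        exact h4.congr_deriv (by ring)
      -- second derivative at `0`
      have hD₁' : HasDerivAt D₁ (iteratedFDeriv ℝ 2 (u ts) xs ![b, b] -
          iteratedFDeriv ℝ 2 (u ts) ys ![b, b] - κ * (2 * ‖b‖ ^ 2)) 0 := by
        rw [hD₁]
        exact ((hD2 xs hxsΩ b b).sub (hD2 ys hysΩ b b)).sub
          (((hasDerivAt_inner_line xs b x₀ 0).const_mul 2).const_mul κ)
      have hval := deriv_deriv_eq_of_eventually hev hD₁'
      have hcont := (hev.self_of_nhds).continuousAt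
      have hle := IsLocalMax.deriv_deriv_nonpos hℓmax hcont
      rw [hval, hb] at hle
      linarith only [hle]
    -- (b) the antiparallel line along `e`: `D²u(xs)(e,e) − D²u(ys)(e,e) ≤ 2κ − 8K₂`
    have hanti : iteratedFDeriv ℝ 2 (u ts) xs ![e, e] - iteratedFDeriv ℝ 2 (u ts) ys ![e, e] ≤
        2 * κ - 8 * K₂ := by
      have hcl : Continuous fun h : ℝ => (xs + h • e, ys + h • (-e)) := by fun_prop
      have hℓmax : IsLocalMax (fun h : ℝ => Φ (ts, xs + h • e, ys + h • (-e))) 0 :=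
        hmax_of (fun h : ℝ => (xs + h • e, ys + h • (-e))) 0 hcl (by simp)
      -- near `0` the distance is `d + 2h`
      have hdist : ∀ h : ℝ, -d < 2 * h → ‖xs + h • e - (ys + h • (-e))‖ = d + 2 * h := by
        intro h hh
        have h1 : xs + h • e - (ys + h • (-e)) = (d + 2 * h) • e := by
          rw [add_smul, ← hde, smul_neg, two_mul, add_smul]; abel
        rw [h1, norm_smul, he1, mul_one, Real.norm_eq_abs, abs_of_pos (by linarith only [hh])]
      have hnear : ∀ᶠ h in 𝓝 (0 : ℝ), -d < 2 * h := by
        have hc : Continuous fun h : ℝ => 2 * h := by fun_prop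
        exact hc.continuousAt.eventually (lt_mem_nhds (by linarith only [hd_pos]))
      have hℓℓ' : (fun h : ℝ => Φ (ts, xs + h • e, ys + h • (-e))) =ᶠ[𝓝 0] fun h =>
          u ts (xs + h • e) - u ts (ys + h • (-e)) - φ (d + 2 * h) -
            κ * ‖xs + h • e - x₀‖ ^ 2 - κ * (t₀ - ts) := by
        filter_upwards [hnear] with h hh
        simp only [hΦ, hdist h hh]
      have hℓ'max := hℓmax.congr hℓℓ'
      -- first derivative of the modified line function near `0`
      obtain ⟨D₁, hD₁⟩ : ∃ D₁ : ℝ → ℝ, D₁ = fun h => fderiv ℝ (u ts) (xs + h • e) e -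
          fderiv ℝ (u ts) (ys + h • (-e)) (-e) - 2 * (K₁ - 2 * K₂ * (d + 2 * h)) -
          κ * (2 * ⟪xs + h • e - x₀, e⟫) := ⟨_, rfl⟩
      have hxs_ev : ∀ᶠ h in 𝓝 (0 : ℝ), xs + h • e ∈ Ω := eventually_line_mem hΩ hxsΩ e
      have hys_ev : ∀ᶠ h in 𝓝 (0 : ℝ), ys + h • (-e) ∈ Ω := eventually_line_mem hΩ hysΩ (-e)
      have hev : ∀ᶠ h in 𝓝 (0 : ℝ), HasDerivAt (fun h : ℝ => u ts (xs + h • e) -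
          u ts (ys + h • (-e)) - φ (d + 2 * h) - κ * ‖xs + h • e - x₀‖ ^ 2 - κ * (t₀ - ts))
          (D₁ h) h := by
        filter_upwards [hxs_ev, hys_ev] with h hxh hyh
        have h1 := hasDerivAt_line_of_differentiableAt (huDiff _ hxh)
        have h2 := hasDerivAt_line_of_differentiableAt (huDiff _ hyh)
        have h3 := (hasDerivAt_norm_sq_line xs e x₀ h).const_mul κ
        have hφc : HasDerivAt (fun s : ℝ => φ (d + 2 * s)) ((K₁ - 2 * K₂ * (d + 2 * h)) * 2) h := by
          have hl : HasDerivAt (fun s : ℝ => d + 2 * s) 2 h := by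
            simpa using ((hasDerivAt_id h).const_mul 2).const_add d
          exact (hφ' (d + 2 * h)).comp h hl
        have h4 := (((h1.sub h2).sub hφc).sub h3).sub (hasDerivAt_const h (κ * (t₀ - ts)))
        rw [hD₁]
        exact h4.congr_deriv (by ring)
      have hD₁' : HasDerivAt D₁ (iteratedFDeriv ℝ 2 (u ts) xs ![e, e] -
          iteratedFDeriv ℝ 2 (u ts) ys ![-e, -e] - 2 * (-(2 * K₂ * 2)) - κ * (2 * ‖e‖ ^ 2)) 0 := by
        have hl1 : HasDerivAt (fun h : ℝ => d + 2 * h) 2 0 := by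
          simpa using ((hasDerivAt_id (0 : ℝ)).const_mul 2).const_add d
        have hlin : HasDerivAt (fun h : ℝ => 2 * (K₁ - 2 * K₂ * (d + 2 * h)))
            (2 * (-(2 * K₂ * 2))) 0 := ((hl1.const_mul (2 * K₂)).const_sub K₁).const_mul 2
        rw [hD₁]
        exact (((hD2 xs hxsΩ e e).sub (hD2 ys hysΩ (-e) (-e))).sub hlin).sub
          (((hasDerivAt_inner_line xs e x₀ 0).const_mul 2).const_mul κ)
      have hval := deriv_deriv_eq_of_eventually hev hD₁'
      have hneg2 : iteratedFDeriv ℝ 2 (u ts) ys ![-e, -e] =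
          iteratedFDeriv ℝ 2 (u ts) ys ![e, e] := by
        simp only [iteratedFDeriv_two_apply, Matrix.cons_val_zero, Matrix.cons_val_one,
          map_neg, neg_apply, neg_neg]
      have hcont := (hev.self_of_nhds).continuousAt
      have hle := IsLocalMax.deriv_deriv_nonpos hℓ'max hcont
      rw [hval, hneg2, he1] at hle
      linarith only [hle]
    -- (c) summing over an orthonormal frame containing `e`
    have hΔ : (Δ (u ts)) xs - (Δ (u ts)) ys ≤ 2 * κ * n - 8 * K₂ := by
      classical
      haveI : Subsingleton (({e} : Set E)) := (Set.subsingleton_coe _).2 subsingleton_singleton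
      have hon : Orthonormal ℝ ((↑) : ({e} : Set E) → E) := by
        rw [orthonormal_subsingleton_iff]
        rintro ⟨w, hw⟩
        rw [mem_singleton_iff] at hw
        simp [hw, he1]
      obtain ⟨w, b, hsub, hb⟩ := hon.exists_orthonormalBasis_extension
      have hew : e ∈ w := by
        have := hsub (mem_singleton e)
        simpa using this
      set i₀ : w := ⟨e, hew⟩ with hi₀
      have hbi₀ : b i₀ = e := by rw [hb]
      have hcard : (Fintype.card w : ℝ) = n := by
        rw [hn, Module.finrank_eq_card_basis b.toBasis]
      obtain ⟨f, hf⟩ : ∃ f : w → ℝ, f = fun i =>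
        iteratedFDeriv ℝ 2 (u ts) xs ![b i, b i] - iteratedFDeriv ℝ 2 (u ts) ys ![b i, b i] :=
        ⟨_, rfl⟩
      have hΔx : (Δ (u ts)) xs = ∑ i, iteratedFDeriv ℝ 2 (u ts) xs ![b i, b i] :=
        congrFun (laplacian_eq_iteratedFDeriv_orthonormalBasis (u ts) b) xs
      have hΔy : (Δ (u ts)) ys = ∑ i, iteratedFDeriv ℝ 2 (u ts) ys ![b i, b i] :=
        congrFun (laplacian_eq_iteratedFDeriv_orthonormalBasis (u ts) b) ys
      have hsum : (Δ (u ts)) xs - (Δ (u ts)) ys = ∑ i, f i := by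
        rw [hΔx, hΔy, ← Finset.sum_sub_distrib, hf]
      have hfi : ∀ i, f i ≤ 2 * κ := fun i => by
        rw [hf]; exact hpar (b i) (b.orthonormal.1 i)
      have hfi₀ : f i₀ ≤ 2 * κ - 8 * K₂ := by rw [hf]; simp only [hbi₀]; exact hanti
      rw [hsum, ← Finset.add_sum_erase _ _ (Finset.mem_univ i₀)]
      have hrest : ∑ i ∈ Finset.univ.erase i₀, f i ≤ ((Finset.univ.erase i₀).card : ℝ) * (2 * κ) := by
        have := Finset.sum_le_card_nsmul (Finset.univ.erase i₀) f (2 * κ) fun i _ => hfi i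
        rwa [nsmul_eq_mul] at this
      have hcard' : ((Finset.univ.erase i₀).card : ℝ) = n - 1 := by
        rw [Finset.card_erase_of_mem (Finset.mem_univ _), Finset.card_univ, Nat.cast_sub, hcard,
          Nat.cast_one]
        exact Fintype.card_pos_iff.2 ⟨i₀⟩
      rw [hcard'] at hrest
      linarith only [hrest, hfi₀]
    ----------------------------------------------------------------
    -- the time argument
    ----------------------------------------------------------------
    obtain ⟨ν, hν⟩ : ∃ ν : ℝ, ν = 4 * K₂ * (1 - A * d₀) := ⟨_, rfl⟩
    have hνpos : 0 < ν := by rw [hν]; exact mul_pos (by positivity) (by linarith only [hAd₀])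
    obtain ⟨J, hJ⟩ : ∃ J : ℝ → ℝ, J = fun τ => (Δ (u τ)) xs + A * ‖fderiv ℝ (u τ) xs‖ -
        (Δ (u τ)) ys + A * ‖fderiv ℝ (u τ) ys‖ + κ := ⟨_, rfl⟩
    have hJc : ContinuousOn J (Icc (t₀ - ρ ^ 2) t₀) := by
      have h1 := continuousOn_time_slice (F := fun p : ℝ × E => (Δ (u p.1)) p.2)
        hu.continuousOn_laplacian hxsΩ hS
      have h2 := continuousOn_time_slice (F := fun p : ℝ × E => fderiv ℝ (u p.1) p.2)
        hu.continuousOn_fderiv hxsΩ hS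
      have h3 := continuousOn_time_slice (F := fun p : ℝ × E => (Δ (u p.1)) p.2)
        hu.continuousOn_laplacian hysΩ hS
      have h4 := continuousOn_time_slice (F := fun p : ℝ × E => fderiv ℝ (u p.1) p.2)
        hu.continuousOn_fderiv hysΩ hS
      rw [hJ]
      exact (((h1.add (continuousOn_const.mul h2.norm)).sub h3).add
        (continuousOn_const.mul h4.norm)).add continuousOn_const
    have hJts : J ts ≤ -ν := by
      have hφ'd := hφ'bd d hd_pos.le hd_lt.le
      have h1 : A * ‖fderiv ℝ (u ts) xs‖ ≤ A * (K₁ + 2 * K₂ * d₀ + 2 * κ * ρ) :=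
        mul_le_mul_of_nonneg_left (hDx.trans (by linarith only [hφ'd])) hA
      have h2 : A * ‖fderiv ℝ (u ts) ys‖ ≤ A * (K₁ + 2 * K₂ * d₀) :=
        mul_le_mul_of_nonneg_left (hDy.trans hφ'd) hA
      have hK₂4 : 4 * K₂ = 4 * c₁ + 2 * A * K₁ := by rw [hK₂]; ring
      rw [hJ, hν]
      simp only
      linarith only [hΔ, h1, h2, hc₁eq, hK₂4]
    -- `J < -ν/2` near `ts`
    obtain ⟨δ₁, hδ₁, hJneg⟩ : ∃ δ₁ > 0, ∀ τ ∈ Icc (t₀ - ρ ^ 2) t₀, dist τ ts < δ₁ →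
        J τ < -ν / 2 := by
      have hev : ∀ᶠ τ in 𝓝[Icc (t₀ - ρ ^ 2) t₀] ts, J τ < -ν / 2 :=
        (hJc ts htsI).eventually (gt_mem_nhds (by linarith only [hJts, hνpos]))
      rw [eventually_nhdsWithin_iff, Metric.eventually_nhds_iff] at hev
      obtain ⟨δ₁, hδ₁, h⟩ := hev
      exact ⟨δ₁, hδ₁, fun τ hτ hd => h hd hτ⟩
    -- the earlier time `t₁`
    obtain ⟨δ, hδ⟩ : ∃ δ : ℝ, δ = min δ₁ (ts - (t₀ - ρ ^ 2)) / 2 := ⟨_, rfl⟩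
    have hmin : 0 < min δ₁ (ts - (t₀ - ρ ^ 2)) := lt_min hδ₁ (by linarith only [hts_gt])
    have hmin1 : min δ₁ (ts - (t₀ - ρ ^ 2)) ≤ δ₁ := min_le_left _ _
    have hmin2 : min δ₁ (ts - (t₀ - ρ ^ 2)) ≤ ts - (t₀ - ρ ^ 2) := min_le_right _ _
    have hδpos : 0 < δ := by rw [hδ]; linarith only [hmin]
    have hδ1 : δ < δ₁ := by rw [hδ]; linarith only [hmin, hmin1]
    have hδ2 : δ < ts - (t₀ - ρ ^ 2) := by rw [hδ]; linarith only [hmin, hmin2]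
    obtain ⟨t₁, ht₁⟩ : ∃ t₁ : ℝ, t₁ = ts - δ := ⟨_, rfl⟩
    have ht₁_gt : t₀ - ρ ^ 2 < t₁ := by rw [ht₁]; linarith only [hδ2]
    have ht₁_lt : t₁ < ts := by rw [ht₁]; linarith only [hδpos]
    have ht₁S : (t₁, xs, ys) ∈ K₀ := ⟨⟨ht₁_gt.le, ht₁_lt.le.trans htsI.2⟩, hxs, hxys⟩
    have hΦle : Φ (t₁, xs, ys) ≤ Φ (ts, xs, ys) := hPmax ht₁S
    -- the integral identity
    have hsubI : Icc t₁ ts ⊆ Icc (t₀ - ρ ^ 2) t₀ := fun τ hτ =>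
      ⟨ht₁_gt.le.trans hτ.1, hτ.2.trans htsI.2⟩
    have hsubS : Icc t₁ ts ⊆ S := hsubI.trans hS
    have ht₁T : t₁ ∈ S := hsubS ⟨le_rfl, ht₁_lt.le⟩
    obtain ⟨I, hI⟩ : ∃ I : E → ℝ → ℝ, I = fun z τ => (Δ (u τ)) z - fderiv ℝ (u τ) z (a τ z) :=
      ⟨_, rfl⟩
    have hix : IntervalIntegrable (I xs) volume t₁ ts := by
      rw [hI]; exact hu.intervalIntegrable hxsΩ ht₁_lt.le hsubS
    have hiy : IntervalIntegrable (I ys) volume t₁ ts := by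
      rw [hI]; exact hu.intervalIntegrable hysΩ ht₁_lt.le hsubS
    have hex := hu.integral_eq xs hxsΩ t₁ ht₁T ts hts ht₁_lt.le
    have hey := hu.integral_eq ys hysΩ t₁ ht₁T ts hts ht₁_lt.le
    have hdiffΦ : Φ (ts, xs, ys) - Φ (t₁, xs, ys) = ∫ τ in t₁..ts, (I xs τ - I ys τ + κ) := by
      rw [intervalIntegral.integral_add (hix.sub hiy) intervalIntegrable_const,
        intervalIntegral.integral_sub hix hiy, intervalIntegral.integral_const, smul_eq_mul]
      simp only [hΦ, hI]
      rw [← hex, ← hey]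
      ring
    -- pointwise bound `I xs − I ys + κ ≤ J < −ν/2` on `[t₁, ts]`
    have hIle : ∀ τ ∈ Icc t₁ ts, I xs τ - I ys τ + κ ≤ -ν / 2 := by
      intro τ hτ
      have hτI : τ ∈ Icc (t₀ - ρ ^ 2) t₀ := hsubI hτ
      have hτS : τ ∈ S := hS hτI
      have hdτ : dist τ ts < δ₁ := by
        rw [Real.dist_eq, abs_sub_comm, abs_of_nonneg (by linarith only [hτ.2])]
        linarith only [hτ.1, ht₁, hδ1]
      have h1 : |fderiv ℝ (u τ) xs (a τ xs)| ≤ A * ‖fderiv ℝ (u τ) xs‖ :=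
        hu.abs_fderiv_apply_drift_le hτS hxsΩ
      have h2 : |fderiv ℝ (u τ) ys (a τ ys)| ≤ A * ‖fderiv ℝ (u τ) ys‖ :=
        hu.abs_fderiv_apply_drift_le hτS hysΩ
      have h3 : I xs τ - I ys τ + κ ≤ J τ := by
        rw [hI, hJ]
        simp only
        linarith only [(abs_le.1 h1).1, (abs_le.1 h2).2]
      exact h3.trans (hJneg τ hτI hdτ).le
    have hIint : IntervalIntegrable (fun τ => I xs τ - I ys τ + κ) volume t₁ ts :=
      (hix.sub hiy).add intervalIntegrable_const
    have hint_le : ∫ τ in t₁..ts, (I xs τ - I ys τ + κ) ≤ ∫ _ in t₁..ts, (-ν / 2 : ℝ) :=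
      intervalIntegral.integral_mono_on ht₁_lt.le hIint intervalIntegrable_const hIle
    have hneg : ∫ τ in t₁..ts, (I xs τ - I ys τ + κ) < 0 := by
      refine hint_le.trans_lt ?_
      rw [intervalIntegral.integral_const, smul_eq_mul]
      nlinarith only [ht₁_lt, hνpos]
    linarith only [hdiffΦ, hneg, hΦle]
  -- **Conclusion** from the claim at `(t₀, x₀, y)`
  intro y hy
  have hyd : ‖x₀ - y‖ ≤ d₀ := by rw [norm_sub_rev]; exact mem_closedBall_iff_norm.1 hy
  have hmem : (t₀, x₀, y) ∈ K₀ := ⟨⟨by linarith only [hρ2], le_rfl⟩, by simp [hρ.le], hyd⟩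
  have h := claim _ hmem
  have hΦ₀ : Φ (t₀, x₀, y) = u t₀ x₀ - u t₀ y - φ ‖x₀ - y‖ := by
    simp only [hΦ, sub_self, norm_zero]; ring
  rw [hΦ₀] at h
  have hφy := hφK₁ ‖x₀ - y‖
  calc u t₀ x₀ - u t₀ y ≤ φ ‖x₀ - y‖ := by linarith only [h]
    _ ≤ K₁ * ‖x₀ - y‖ := hφy
    _ = lipConst A ρ (Module.finrank ℝ E) * M * ‖x₀ - y‖ := by rw [hK₁, hn]; ring

/-- **Interior Lipschitz estimate, two-sided form**: under the hypotheses of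
`IsDriftHeatSolutionOn.sub_le_lipConst`, `|u(t₀, y) − u(t₀, x₀)| ≤ lipConst A ρ n · M · ‖y − x₀‖`
for `‖y − x₀‖ ≤ lipRad A ρ` (apply the one-sided form to `u` and to `−u`). [folklore] -/
theorem IsDriftHeatSolutionOn.abs_sub_le_lipConst (hu : IsDriftHeatSolutionOn a u A S Ω)
    (hΩ : IsOpen Ω) {x₀ : E} {t₀ ρ M : ℝ} (hρ : 0 < ρ) (hM : 0 < M)
    (hball : closedBall x₀ (2 * ρ) ⊆ Ω) (hS : Icc (t₀ - ρ ^ 2) t₀ ⊆ S)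
    (hbd : ∀ t ∈ Icc (t₀ - ρ ^ 2) t₀, ∀ x ∈ closedBall x₀ (2 * ρ), |u t x| ≤ M) :
    ∀ y ∈ closedBall x₀ (lipRad A ρ),
      |u t₀ y - u t₀ x₀| ≤ lipConst A ρ (Module.finrank ℝ E) * M * ‖y - x₀‖ := by
  intro y hy
  have h1 := hu.sub_le_lipConst hΩ hρ hM hball hS hbd y hy
  have hbd' : ∀ t ∈ Icc (t₀ - ρ ^ 2) t₀, ∀ x ∈ closedBall x₀ (2 * ρ), |(fun t x => -u t x) t x| ≤ M :=
    fun t ht x hx => by simpa [abs_neg] using hbd t ht x hx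
  have h2 := hu.neg.sub_le_lipConst hΩ hρ hM hball hS hbd' y hy
  rw [norm_sub_rev] at h1 h2
  rw [abs_le]
  constructor <;> linarith

end Lipschitz

end Literature.Analysis.FluidPDE

end
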